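import Summits.BirchSwinnertonDyer.Rank1Residual.GaloisImage.InertiaInvariantHenselLift
import Summits.BirchSwinnertonDyer.Rank1Residual.GaloisImage.CuspidalReductionLang
import HarnessLib

/-!
# Lang + Hensel at an ADDITIVE place: `m ≡ φ b − b (mod V₁)` with `b` fixed by inertia, for a
# `K_v`-point `m` of the minimal model with NONSINGULAR (cuspidal) reduction
# (cell `b2b-bsdres`, team n1011, seat p10 GEN 8; THEOREM A programme, FILE 7b; plan
# `HOME/b2b-bsdres-n1011-p10/g8/THEOREM-A-PLAN.md`)

HONEST FRAMING (cell `b2b-bsdres`, run/shared/lean/b2b/bsd-rank1-residual/, verbatim in every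
file): the goal of the cell is to DELETE the COMBINATION-SHAPED residual classes of the
Birch–Swinnerton-Dyer formula for ALL analytic-rank `≤ 1` elliptic curves over `ℚ` — "full BSD
formula for every rank `≤ 1` curve in class `C`" assembled STRICTLY from published theorems — so
that the rank-`≤ 1` remainder becomes exactly the CONSTRUCTION-SHAPED classes, which are TYPED
(missing-input `Prop`s), NOT attempted. This is not "finishing BSD". Team n1011 (N10 / N11):
research route on the CONSTRUCTION-SHAPED class X4 (§I N11 LOWER half); no claim beyond the stated
classes; nothing is booked; marks UNCHANGED. Theorems only: no definition, no named fact, no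
`sorry`. TOOL theorems; they close nothing by themselves.

## What

The additive-reduction companion of the tree's
`WeierstrassCurve.exists_lift_sub_mem_kernel` (`GoodReductionLangLift`, good reduction: Lang's
theorem on the elliptic curve `Ẽ_v` + Hensel). Setting: `K` a number field, `v` a finite place,
`K̄_v` with its spectral valuation `w`, `M = M`, `V = (M ⊗ K_v) ⊗ K̄_v`,
`𝔐 ∈ v.localPrimesAbove`, `φ ∈ Γ_{K_v}` an arithmetic Frobenius (`|φ z − z^{q_v}| < 1` on
`𝒪_w`). HYPOTHESES replacing good reduction: the reduction `M mod 𝔪_v` of the given integral model `M` (elliptic over `K_v`; e.g. a minimal model, but minimality is not used) is the CUSPIDAL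
singular model `singularModel x₀ y₀ α α` with `x₀, y₀, α ∈ k_v` (additive reduction, cusp and
tangent slope rational — automatic in residue characteristic `≠ 2`), and the point `m` is the image
of an INTEGRAL `K_v`-point `(a, b)` of `M` whose reduction `(ā, b̄)` is NONSINGULAR (`m ∈ E₀`).
CONCLUSION (`exists_lift_sub_mem_kernel_of_cusp`): there is `b ∈ V(K̄_v)` fixed by the inertia
group `I_𝔐` with `m − (φ b − b) ∈ V₁(K̄_v)` (`FormalGroupChart.kernel`). Proof = the tree's proof
with (i) the reduction HOMOMORPHISM ON `E₀` at singular reduction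
(`ReductionHomomorphism`: `reducePoint_add/neg`, `HasNonsingularReduction.add/neg`,
`reducePoint_eq_zero_iff`, *AEC* VII.2.1) in place of `goodReductionHom`, and (ii) Lang's theorem
for the cusp (`exists_map_frob_sub_eq_of_cusp`, FILE 7a) in place of the isogeny `1 − Frob`; the
inertia-invariant Hensel lift of a nonsingular point of the reduction (Teichmüller in one
coordinate, Hensel at a non-vanishing partial in the other) is verbatim the tree's.

References: [MilneADT2006] Ch. I, proof of Prop. 3.8 (Lang + Hensel, there at good reduction);
[SilvermanAEC2009] VII.2.1, III.2.5; Lang–Tate, Amer. J. Math. 80 (1958).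
-/

noncomputable section

open scoped Classical NNReal
open NumberField IsDedekindDomain Field Polynomial

universe u

namespace Summit.BirchSwinnertonDyer.Rank1Residual.GaloisImage.TwistedWitness

open WeierstrassCurve Literature.NumberTheory.EllipticCurves Literature.NumberTheory.GaloisRepresentations
  Literature.NumberTheory.GaloisRepresentations.IsNonarchimedeanLocalField
  IsDedekindDomain.HeightOneSpectrum

variable {K : Type u} [Field K] [NumberField K] {v : HeightOneSpectrum (𝓞 K)}
  {w : Valuation (AlgebraicClosure (v.adicCompletion K)) ℝ≥0}
  (hw : ∀ x, (w x : ℝ) = spectralNorm (v.adicCompletion K) (AlgebraicClosure (v.adicCompletion K)) x)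
  {M : WeierstrassCurve (v.adicCompletionIntegers K)}

include hw in
set_option maxHeartbeats 1600000 in
/-- **Lang's theorem + Hensel lifting for the minimal model at an ADDITIVE place.** With
`M.map (IsLocalRing.residue (v.adicCompletionIntegers K)) = singularModel x₀ y₀ α α` (cusp `(x₀, y₀)`, tangent slope `α`, all in `k_v`),
`φ ∈ Γ_{K_v}` an arithmetic Frobenius modulo `𝔐`, and `m = (a, b)` an integral `K_v`-point of the
minimal model with nonsingular reduction `(ā, b̄)`: there is `b ∈ V(K̄_v)` fixed by `I_𝔐` with
`m − (φ b − b) ∈ V₁(K̄_v)`. (Reduce by the homomorphism `E₀ → Ẽ_ns(k₀)` of *AEC* VII.2.1, apply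
Lang's theorem on the cusp `Ẽ_ns ≅ 𝔾_a` — FILE 7a — to get `m̃ = Fβ − β`, lift `β` invariantly by
Teichmüller + Hensel as in the tree's good-reduction proof.)
[cite: MilneADT2006, Ch. I Prop. 3.8 (proof)] [cite: SilvermanAEC2009, Prop. VII.2.1 and Prop. III.2.5] -/
theorem exists_lift_sub_mem_kernel_of_cusp
    [hMell : (M.map (algebraMap (v.adicCompletionIntegers K) (v.adicCompletion K))).IsElliptic]
    {𝔐 : Ideal v.localAbsIntegers} (h𝔐 : 𝔐 ∈ v.localPrimesAbove)
    [hV : ((M.map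
        (algebraMap (v.adicCompletionIntegers K) (v.adicCompletion K))).baseChange
        (AlgebraicClosure (v.adicCompletion K))).IsIntegral w.integer]
    (x₀ y₀ α : IsLocalRing.ResidueField (v.adicCompletionIntegers K))
    (hcusp : M.map (IsLocalRing.residue (v.adicCompletionIntegers K)) = singularModel x₀ y₀ α α)
    {φ : absoluteGaloisGroup (v.adicCompletion K)}
    (hφq : ∀ z : AlgebraicClosure (v.adicCompletion K), w z ≤ 1 →
      w (absoluteGaloisGroup.toAlgEquiv (v.adicCompletion K) φ z -
        z ^ Nat.card (IsLocalRing.ResidueField (v.adicCompletionIntegers K))) < 1)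
    {a₀ b₀ : v.adicCompletionIntegers K}
    (hns₀ : (M.map (IsLocalRing.residue (v.adicCompletionIntegers K))).toAffine.Nonsingular
      (IsLocalRing.residue (v.adicCompletionIntegers K) a₀)
      (IsLocalRing.residue (v.adicCompletionIntegers K) b₀))
    (hm : ((M.map
        (algebraMap (v.adicCompletionIntegers K) (v.adicCompletion K))).baseChange
        (AlgebraicClosure (v.adicCompletion K))).toAffine.Nonsingular
      (algebraMap (v.adicCompletionIntegers K) (AlgebraicClosure (v.adicCompletion K)) a₀)
      (algebraMap (v.adicCompletionIntegers K) (AlgebraicClosure (v.adicCompletion K)) b₀)) :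
    ∃ b : ((M.map
        (algebraMap (v.adicCompletionIntegers K) (v.adicCompletion K))).baseChange
        (AlgebraicClosure (v.adicCompletion K))).toAffine.Point,
      (∀ τ ∈ 𝔐.inertia (absoluteGaloisGroup (v.adicCompletion K)),
        Affine.Point.map ((absoluteGaloisGroup.toAlgEquiv (v.adicCompletion K) τ :
          AlgebraicClosure (v.adicCompletion K) ≃ₐ[v.adicCompletion K] AlgebraicClosure (v.adicCompletion K)) :
          AlgebraicClosure (v.adicCompletion K) →ₐ[v.adicCompletion K] AlgebraicClosure (v.adicCompletion K)) b = b) ∧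
      Affine.Point.some _ _ hm - (Affine.Point.map ((absoluteGaloisGroup.toAlgEquiv (v.adicCompletion K) φ :
          AlgebraicClosure (v.adicCompletion K) ≃ₐ[v.adicCompletion K] AlgebraicClosure (v.adicCompletion K)) :
          AlgebraicClosure (v.adicCompletion K) →ₐ[v.adicCompletion K] AlgebraicClosure (v.adicCompletion K)) b - b)
        ∈ FormalGroupChart.kernel w ((M.map
            (algebraMap (v.adicCompletionIntegers K) (v.adicCompletion K))).baseChange
            (AlgebraicClosure (v.adicCompletion K))) := by
  have hvw : w.Integers w.integer := Valuation.integer.integers w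
  have hφw : ∀ z, w (absoluteGaloisGroup.toAlgEquiv (v.adicCompletion K) φ z) = w z :=
    fun z ↦ spectralValuation_smul hw φ z
  -- the model over `𝒪_w`
  obtain ⟨ι, hι⟩ := exists_ringHom_adicCompletionIntegers_integer (v := v) hw
  haveI hιloc := isLocalHom_of_coe_eq hw hι
  set W₀ : WeierstrassCurve w.integer := M.map ι with hW₀
  have hcompL : (algebraMap w.integer (AlgebraicClosure (v.adicCompletion K))).comp ι =
      (algebraMap (v.adicCompletion K) (AlgebraicClosure (v.adicCompletion K))).comp
        (algebraMap (v.adicCompletionIntegers K) (v.adicCompletion K)) := by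
    ext a
    exact hι a
  have hX : (M.map (algebraMap (v.adicCompletionIntegers K) (v.adicCompletion K))).baseChange
      (AlgebraicClosure (v.adicCompletion K)) = W₀.baseChange (AlgebraicClosure (v.adicCompletion K)) := by
    simp only [baseChange, hW₀, WeierstrassCurve.map_map, hcompL]
  -- the reduction map `V(K̄_v) → Ẽ_ns(k₀)` (a homomorphism on `E₀`, *AEC* VII.2.1) and its kernel
  set red : ((M.map (algebraMap (v.adicCompletionIntegers K) (v.adicCompletion K))).baseChange
      (AlgebraicClosure (v.adicCompletion K))).toAffine.Point →
      (W₀.map (IsLocalRing.residue w.integer)).toAffine.Point :=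
    fun P ↦ W₀.reducePoint (Affine.Point.congrEquiv hX P) with hred
  have hred_apply : ∀ P, red P = W₀.reducePoint (Affine.Point.congrEquiv hX P) := fun _ ↦ rfl
  have hker : ∀ P, W₀.ReducesToZero (Affine.Point.congrEquiv hX P) ↔
      P ∈ FormalGroupChart.kernel w ((M.map (algebraMap (v.adicCompletionIntegers K)
      (v.adicCompletion K))).baseChange (AlgebraicClosure (v.adicCompletion K))) := by
    intro P
    rcases P with _ | ⟨x, y, h⟩
    · rw [← Affine.Point.zero_def, map_zero]
      exact iff_of_true WeierstrassCurve.reducesToZero_zero (FormalGroupChart.kernel w _).zero_mem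
    · rw [Affine.Point.congrEquiv_some, WeierstrassCurve.reducesToZero_some_iff,
        not_mem_range_iff hvw, FormalGroupChart.some_mem_kernel_iff]
  -- integral points with nonsingular reduction and their reductions
  have hred_some : ∀ (x y : AlgebraicClosure (v.adicCompletion K)) (hx : w x ≤ 1) (hy : w y ≤ 1)
      (h : ((M.map (algebraMap (v.adicCompletionIntegers K)
        (v.adicCompletion K))).baseChange (AlgebraicClosure (v.adicCompletion K))).toAffine.Nonsingular x y)
      (hns : (W₀.map (IsLocalRing.residue w.integer)).toAffine.Nonsingular
        (IsLocalRing.residue w.integer ⟨x, hx⟩) (IsLocalRing.residue w.integer ⟨y, hy⟩)),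
      red (.some _ _ h) =
        .some (IsLocalRing.residue w.integer ⟨x, hx⟩) (IsLocalRing.residue w.integer ⟨y, hy⟩) hns ∧
      W₀.HasNonsingularReduction (Affine.Point.congrEquiv hX (.some _ _ h)) := by
    intro x y hx hy h hns
    have hh : (W₀.baseChange (AlgebraicClosure (v.adicCompletion K))).toAffine.Nonsingular
        (algebraMap w.integer _ ⟨x, hx⟩) (algebraMap w.integer _ ⟨y, hy⟩) := by
      have := h; rw [hX] at this; exact this
    rw [hred_apply, Affine.Point.congrEquiv_some]
    change W₀.reducePoint (.some _ _ hh) = _ ∧ W₀.HasNonsingularReduction (.some _ _ hh)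
    exact ⟨reducePoint_some_algebraMap hvw.hom_inj hh hns,
      (hasNonsingularReduction_some_algebraMap_iff hvw.hom_inj hh).mpr hns⟩
  -- the coefficients of `W₀` are fixed by `Γ_{K_v}`, in particular by `I_𝔐`
  have hfixι : ∀ (σ : absoluteGaloisGroup (v.adicCompletion K)) (c : v.adicCompletionIntegers K),
      absoluteGaloisGroup.toAlgEquiv (v.adicCompletion K) σ ((ι c : w.integer) : AlgebraicClosure (v.adicCompletion K)) = ι c :=
    fun σ c ↦ by rw [hι]; exact AlgEquiv.commutes _ _
  have hW₀I : ∀ τ ∈ 𝔐.inertia (absoluteGaloisGroup (v.adicCompletion K)),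
      absoluteGaloisGroup.toAlgEquiv (v.adicCompletion K) τ (W₀.a₁ : AlgebraicClosure (v.adicCompletion K)) = W₀.a₁ ∧
      absoluteGaloisGroup.toAlgEquiv (v.adicCompletion K) τ (W₀.a₂ : AlgebraicClosure (v.adicCompletion K)) = W₀.a₂ ∧
      absoluteGaloisGroup.toAlgEquiv (v.adicCompletion K) τ (W₀.a₃ : AlgebraicClosure (v.adicCompletion K)) = W₀.a₃ ∧
      absoluteGaloisGroup.toAlgEquiv (v.adicCompletion K) τ (W₀.a₄ : AlgebraicClosure (v.adicCompletion K)) = W₀.a₄ ∧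
      absoluteGaloisGroup.toAlgEquiv (v.adicCompletion K) τ (W₀.a₆ : AlgebraicClosure (v.adicCompletion K)) = W₀.a₆ := by
    intro τ _
    simp only [hW₀, map_a₁, map_a₂, map_a₃, map_a₄, map_a₆]
    exact ⟨hfixι τ _, hfixι τ _, hfixι τ _, hfixι τ _, hfixι τ _⟩
  -- the residue fields `k = k_v ⊆ k₀ = 𝒪_w/𝔪_w`, `q = #k`, the `q`-Frobenius of `k₀`
  letI algk : Algebra (IsLocalRing.ResidueField (v.adicCompletionIntegers K))
      (IsLocalRing.ResidueField w.integer) := (IsLocalRing.ResidueField.map ι).toAlgebra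
  haveI : Finite (IsLocalRing.ResidueField (v.adicCompletionIntegers K)) :=
    finite_residueField_adicCompletionIntegers K v
  letI := Fintype.ofFinite (IsLocalRing.ResidueField (v.adicCompletionIntegers K))
  obtain ⟨p, hchar, n, hp, hcard⟩ := FiniteField.card' (IsLocalRing.ResidueField (v.adicCompletionIntegers K))
  haveI : CharP (IsLocalRing.ResidueField (v.adicCompletionIntegers K)) p := hchar
  haveI hcharp : CharP (IsLocalRing.ResidueField w.integer) p :=
    charP_of_injective_algebraMap (algebraMap (IsLocalRing.ResidueField (v.adicCompletionIntegers K))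
      (IsLocalRing.ResidueField w.integer)).injective p
  haveI : Fact p.Prime := ⟨hp⟩
  haveI : ExpChar (IsLocalRing.ResidueField w.integer) p := ExpChar.prime hp
  haveI : IsAlgClosed (IsLocalRing.ResidueField w.integer) := isAlgClosed_residueField_integer w
  haveI : PerfectField (IsLocalRing.ResidueField w.integer) := IsAlgClosed.perfectField _
  have hq : Nat.card (IsLocalRing.ResidueField (v.adicCompletionIntegers K)) = p ^ (n : ℕ) := by
    rw [Nat.card_eq_fintype_card, hcard]
  let Fq : IsLocalRing.ResidueField w.integer ≃+* IsLocalRing.ResidueField w.integer :=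
    iterateFrobeniusEquiv (IsLocalRing.ResidueField w.integer) p n
  have hFq : ∀ x, Fq x = x ^ Nat.card (IsLocalRing.ResidueField (v.adicCompletionIntegers K)) :=
    fun x ↦ by rw [hq]; exact iterateFrobeniusEquiv_apply _ p n x
  have hFqk : ∀ c : IsLocalRing.ResidueField (v.adicCompletionIntegers K),
      Fq (algebraMap _ (IsLocalRing.ResidueField w.integer) c) = algebraMap _ _ c := fun c ↦ by
    rw [hFq, ← map_pow, Nat.card_eq_fintype_card, FiniteField.pow_card]
  let Fqa : IsLocalRing.ResidueField w.integer ≃ₐ[IsLocalRing.ResidueField (v.adicCompletionIntegers K)]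
      IsLocalRing.ResidueField w.integer := { Fq with commutes' := hFqk }
  have hFqa : ∀ x, Fqa x = x ^ Nat.card (IsLocalRing.ResidueField (v.adicCompletionIntegers K)) := hFq
  haveI : Algebra.IsAlgebraic (IsLocalRing.ResidueField (v.adicCompletionIntegers K))
      (IsLocalRing.ResidueField w.integer) := isAlgebraic_residueField_integer hw hι
  haveI : IsAlgClosure (IsLocalRing.ResidueField (v.adicCompletionIntegers K))
      (IsLocalRing.ResidueField w.integer) := IsAlgClosure.mk inferInstance inferInstance
  -- the reduced equation is `Ẽ_v ⊗ k₀`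
  have hWt : W₀.map (IsLocalRing.residue w.integer) =
      (M.map (IsLocalRing.residue (v.adicCompletionIntegers K))).baseChange (IsLocalRing.ResidueField w.integer) := by
    rw [baseChange, WeierstrassCurve.map_map, WeierstrassCurve.map_map]
    congr 1
  -- residues of `q`-th power congruent elements
  have hresφ : ∀ (z x' : AlgebraicClosure (v.adicCompletion K)) (hz : w z ≤ 1) (hx' : w x' ≤ 1),
      w (x' - z ^ Nat.card (IsLocalRing.ResidueField (v.adicCompletionIntegers K))) < 1 →
      IsLocalRing.residue w.integer ⟨x', hx'⟩ = Fqa (IsLocalRing.residue w.integer ⟨z, hz⟩) := by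
    intro z x' hz hx' hcong
    rw [hFqa, ← map_pow]
    have hzq : w (z ^ Nat.card (IsLocalRing.ResidueField (v.adicCompletionIntegers K))) ≤ 1 := by
      rw [map_pow]; exact pow_le_one₀ zero_le hz
    rw [WeierstrassCurve.residue_eq_of_val_sub_lt_one (w := w) hzq hx' hcong]
    rfl
  -- (R3) `φ` reduces to the `q`-Frobenius
  -- the reduced equation is the cuspidal singular model over `k₀`
  have hWt' : W₀.map (IsLocalRing.residue w.integer) =
      (singularModel x₀ y₀ α α).baseChange (IsLocalRing.ResidueField w.integer) := by
    rw [hWt, hcusp]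
  -- `Fq` fixes the reduced equation, hence preserves nonsingularity of residues
  have hfixFq : (W₀.map (IsLocalRing.residue w.integer)).map
      (Fqa : IsLocalRing.ResidueField w.integer →+* IsLocalRing.ResidueField w.integer) =
      W₀.map (IsLocalRing.residue w.integer) := by
    rw [hWt, baseChange, WeierstrassCurve.map_map]
    congr 1
    ext c
    exact hFqk c
  have hnsFq : ∀ {s t : IsLocalRing.ResidueField w.integer},
      (W₀.map (IsLocalRing.residue w.integer)).toAffine.Nonsingular s t →
      (W₀.map (IsLocalRing.residue w.integer)).toAffine.Nonsingular (Fqa s) (Fqa t) := by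
    intro s t hst
    have := (Affine.map_nonsingular (W := W₀.map (IsLocalRing.residue w.integer))
      (f := (Fqa : IsLocalRing.ResidueField w.integer →+* IsLocalRing.ResidueField w.integer))
      (RingHom.injective _) s t).mpr hst
    have h2 : ((W₀.map (IsLocalRing.residue w.integer)).map
        (Fqa : IsLocalRing.ResidueField w.integer →+* IsLocalRing.ResidueField w.integer)).toAffine.Nonsingular
        (Fqa s) (Fqa t) := this
    rw [hfixFq] at h2
    exact h2
  -- (R3) `φ` reduces to the `q`-Frobenius on integral points with nonsingular reduction
  have hredφ : ∀ (x y : AlgebraicClosure (v.adicCompletion K)) (hx : w x ≤ 1) (hy : w y ≤ 1)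
      (h : ((M.map (algebraMap (v.adicCompletionIntegers K)
        (v.adicCompletion K))).baseChange (AlgebraicClosure (v.adicCompletion K))).toAffine.Nonsingular x y)
      (hns : (W₀.map (IsLocalRing.residue w.integer)).toAffine.Nonsingular
        (IsLocalRing.residue w.integer ⟨x, hx⟩) (IsLocalRing.residue w.integer ⟨y, hy⟩)),
      red (Affine.Point.map ((absoluteGaloisGroup.toAlgEquiv (v.adicCompletion K) φ :
          AlgebraicClosure (v.adicCompletion K) ≃ₐ[v.adicCompletion K] AlgebraicClosure (v.adicCompletion K)) :
          AlgebraicClosure (v.adicCompletion K) →ₐ[v.adicCompletion K] AlgebraicClosure (v.adicCompletion K)) (.some _ _ h))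
        = Affine.Point.congrEquiv hWt'.symm (Affine.Point.map
            (Fqa : IsLocalRing.ResidueField w.integer →ₐ[IsLocalRing.ResidueField (v.adicCompletionIntegers K)]
              IsLocalRing.ResidueField w.integer) (Affine.Point.congrEquiv hWt' (red (.some _ _ h)))) ∧
      W₀.HasNonsingularReduction (Affine.Point.congrEquiv hX (Affine.Point.map
          ((absoluteGaloisGroup.toAlgEquiv (v.adicCompletion K) φ :
          AlgebraicClosure (v.adicCompletion K) ≃ₐ[v.adicCompletion K] AlgebraicClosure (v.adicCompletion K)) :
          AlgebraicClosure (v.adicCompletion K) →ₐ[v.adicCompletion K] AlgebraicClosure (v.adicCompletion K)) (.some _ _ h))) := by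
    intro x y hx hy h hns
    have hφx : w (((absoluteGaloisGroup.toAlgEquiv (v.adicCompletion K) φ :
      AlgebraicClosure (v.adicCompletion K) ≃ₐ[v.adicCompletion K] AlgebraicClosure (v.adicCompletion K)) :
      AlgebraicClosure (v.adicCompletion K) →ₐ[v.adicCompletion K] AlgebraicClosure (v.adicCompletion K)) x) ≤ 1 := by
      change w (absoluteGaloisGroup.toAlgEquiv (v.adicCompletion K) φ x) ≤ 1
      rw [hφw]; exact hx
    have hφy : w (((absoluteGaloisGroup.toAlgEquiv (v.adicCompletion K) φ :
      AlgebraicClosure (v.adicCompletion K) ≃ₐ[v.adicCompletion K] AlgebraicClosure (v.adicCompletion K)) :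
      AlgebraicClosure (v.adicCompletion K) →ₐ[v.adicCompletion K] AlgebraicClosure (v.adicCompletion K)) y) ≤ 1 := by
      change w (absoluteGaloisGroup.toAlgEquiv (v.adicCompletion K) φ y) ≤ 1
      rw [hφw]; exact hy
    have ex : IsLocalRing.residue w.integer ⟨_, hφx⟩ = Fqa (IsLocalRing.residue w.integer ⟨x, hx⟩) :=
      hresφ x _ hx hφx (by exact hφq x hx)
    have ey : IsLocalRing.residue w.integer ⟨_, hφy⟩ = Fqa (IsLocalRing.residue w.integer ⟨y, hy⟩) :=
      hresφ y _ hy hφy (by exact hφq y hy)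
    have hns₁ : (W₀.map (IsLocalRing.residue w.integer)).toAffine.Nonsingular
        (IsLocalRing.residue w.integer ⟨_, hφx⟩) (IsLocalRing.residue w.integer ⟨_, hφy⟩) := by
      rw [ex, ey]; exact hnsFq hns
    obtain ⟨e₂, -⟩ := hred_some x y hx hy h hns
    generalize hP' : Affine.Point.map ((absoluteGaloisGroup.toAlgEquiv (v.adicCompletion K) φ :
      AlgebraicClosure (v.adicCompletion K) ≃ₐ[v.adicCompletion K] AlgebraicClosure (v.adicCompletion K)) :
      AlgebraicClosure (v.adicCompletion K) →ₐ[v.adicCompletion K] AlgebraicClosure (v.adicCompletion K))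
      (.some x y h) = P'
    rcases P' with _ | ⟨x', y', h'⟩
    · rw [Affine.Point.map_some] at hP'
      exact (Affine.Point.some_ne_zero _ hP').elim
    rw [Affine.Point.map_some] at hP'
    simp only [Affine.Point.some.injEq] at hP'
    obtain ⟨rfl, rfl⟩ := hP'
    obtain ⟨e₁, hE0₁⟩ := hred_some _ _ hφx hφy h' hns₁
    refine ⟨?_, hE0₁⟩
    rw [e₁, e₂, Affine.Point.congrEquiv_some, Affine.Point.map_some, Affine.Point.congrEquiv_some]
    exact point_some_eq_some ex ey
  -- the point `m` and its (nonsingular, non-zero) reduction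
  have ha₀ι : (algebraMap (v.adicCompletionIntegers K) (AlgebraicClosure (v.adicCompletion K)) a₀) =
      ((ι a₀ : w.integer) : AlgebraicClosure (v.adicCompletion K)) := by
    rw [hι, IsScalarTower.algebraMap_apply (v.adicCompletionIntegers K) (v.adicCompletion K)
      (AlgebraicClosure (v.adicCompletion K))]
    rfl
  have hb₀ι : (algebraMap (v.adicCompletionIntegers K) (AlgebraicClosure (v.adicCompletion K)) b₀) =
      ((ι b₀ : w.integer) : AlgebraicClosure (v.adicCompletion K)) := by
    rw [hι, IsScalarTower.algebraMap_apply (v.adicCompletionIntegers K) (v.adicCompletion K)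
      (AlgebraicClosure (v.adicCompletion K))]
    rfl
  have hma : w (algebraMap (v.adicCompletionIntegers K) (AlgebraicClosure (v.adicCompletion K)) a₀) ≤ 1 := by
    rw [ha₀ι]; exact (ι a₀).2
  have hmb : w (algebraMap (v.adicCompletionIntegers K) (AlgebraicClosure (v.adicCompletion K)) b₀) ≤ 1 := by
    rw [hb₀ι]; exact (ι b₀).2
  have hres_ι : ∀ c : v.adicCompletionIntegers K, IsLocalRing.residue w.integer (ι c) =
      algebraMap (IsLocalRing.ResidueField (v.adicCompletionIntegers K)) (IsLocalRing.ResidueField w.integer)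
        (IsLocalRing.residue (v.adicCompletionIntegers K) c) := fun c ↦
    (IsLocalRing.ResidueField.map_residue ι c).symm
  have hns_m : (W₀.map (IsLocalRing.residue w.integer)).toAffine.Nonsingular
      (IsLocalRing.residue w.integer ⟨_, hma⟩) (IsLocalRing.residue w.integer ⟨_, hmb⟩) := by
    have e1 : (⟨_, hma⟩ : w.integer) = ι a₀ := Subtype.ext ha₀ι
    have e2 : (⟨_, hmb⟩ : w.integer) = ι b₀ := Subtype.ext hb₀ι
    rw [e1, e2, hres_ι, hres_ι, hWt]
    exact (Affine.map_nonsingular (W := M.map (IsLocalRing.residue (v.adicCompletionIntegers K)))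
      (f := algebraMap (IsLocalRing.ResidueField (v.adicCompletionIntegers K)) (IsLocalRing.ResidueField w.integer))
      (RingHom.injective _) _ _).mpr hns₀
  obtain ⟨hred_m, hE0m⟩ := hred_some _ _ hma hmb hm hns_m
  have hm0 : red (.some _ _ hm) ≠ 0 := by
    rw [hred_m]; exact Affine.Point.some_ne_zero _
  -- (R4) Lang's theorem on the cusp: `\tilde m = F β - β`
  obtain ⟨Q₁, hQ₁⟩ := exists_map_frob_sub_eq_of_cusp x₀ y₀ α Fqa hFqa (Affine.Point.congrEquiv hWt' (red (.some _ _ hm)))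
  set Q : (W₀.map (IsLocalRing.residue w.integer)).toAffine.Point := Affine.Point.congrEquiv hWt'.symm Q₁ with hQdef
  have hQ₁' : Q₁ = Affine.Point.congrEquiv hWt' Q := by
    rw [hQdef, congrEquiv_apply_congrEquiv_symm]
  have hQ0 : Q ≠ 0 := by
    intro hQ0
    apply hm0
    rw [hQ0, map_zero] at hQ₁'
    rw [hQ₁', map_zero, sub_self] at hQ₁
    exact (Affine.Point.congrEquiv hWt').injective (by rw [← hQ₁, map_zero])
  -- (R5) an `I_𝔐`-invariant integral lift `(a, b)` of `Q = (α₀, β₀)`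
  haveI hVell : ((M.map (algebraMap (v.adicCompletionIntegers K) (v.adicCompletion K))).baseChange
      (AlgebraicClosure (v.adicCompletion K))).IsElliptic :=
    inferInstance
  have hWeq : ∀ a b : w.integer, W₀.toAffine.Equation a b →
      ((M.map (algebraMap (v.adicCompletionIntegers K) (v.adicCompletion K))).baseChange
        (AlgebraicClosure (v.adicCompletion K))).toAffine.Nonsingular
        (a : AlgebraicClosure (v.adicCompletion K)) (b : AlgebraicClosure (v.adicCompletion K)) := by
    intro a b hab
    rw [← Affine.equation_iff_nonsingular, hX]
    exact (map_equation_iff hvw.hom_inj).mpr hab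
  have lift : ∃ (a b : w.integer) (hL : ((M.map (algebraMap (v.adicCompletionIntegers K)
      (v.adicCompletion K))).baseChange (AlgebraicClosure (v.adicCompletion K))).toAffine.Nonsingular
        (a : AlgebraicClosure (v.adicCompletion K)) (b : AlgebraicClosure (v.adicCompletion K))),
      red (.some _ _ hL) = Q ∧ (∀ τ ∈ 𝔐.inertia (absoluteGaloisGroup (v.adicCompletion K)),
        absoluteGaloisGroup.toAlgEquiv (v.adicCompletion K) τ (a : AlgebraicClosure (v.adicCompletion K)) = a ∧
        absoluteGaloisGroup.toAlgEquiv (v.adicCompletion K) τ (b : AlgebraicClosure (v.adicCompletion K)) = b) ∧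
      (W₀.map (IsLocalRing.residue w.integer)).toAffine.Nonsingular
        (IsLocalRing.residue w.integer ⟨(a : AlgebraicClosure (v.adicCompletion K)), a.2⟩)
        (IsLocalRing.residue w.integer ⟨(b : AlgebraicClosure (v.adicCompletion K)), b.2⟩) := by
    clear_value Q
    rcases Q with _ | ⟨α₀, β₀, hns⟩
    · exact (hQ0 rfl).elim
    obtain ⟨a, b, hWab, ha, hb, hI⟩ := exists_inertia_invariant_lift hw h𝔐 W₀ hW₀I hns
    have hns' : (W₀.map (IsLocalRing.residue w.integer)).toAffine.Nonsingular
        (IsLocalRing.residue w.integer ⟨(a : AlgebraicClosure (v.adicCompletion K)), a.2⟩)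
        (IsLocalRing.residue w.integer ⟨(b : AlgebraicClosure (v.adicCompletion K)), b.2⟩) := by
      simp only [Subtype.coe_eta]; rw [ha, hb]; exact hns
    obtain ⟨e', -⟩ := hred_some _ _ a.2 b.2 (hWeq a b hWab) hns'
    refine ⟨a, b, hWeq a b hWab, ?_, hI, hns'⟩
    rw [e']
    exact point_some_eq_some (by simpa only [Subtype.coe_eta] using ha)
      (by simpa only [Subtype.coe_eta] using hb)
  -- (R6) conclusion: `m - (φB - B) ∈ E₀` reduces to `m̃ - (Fβ - β) = Õ`, hence lies in `E₁ = V₁`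
  obtain ⟨a, b, hL, hredb, hI, hnsb⟩ := lift
  refine ⟨.some _ _ hL, fun τ hτ ↦ ?_, ?_⟩
  · rw [Affine.Point.map_some]
    exact point_some_eq_some (hI τ hτ).1 (hI τ hτ).2
  · obtain ⟨hredφb, hE0φb⟩ := hredφ _ _ a.2 b.2 hL hnsb
    have hE0b : W₀.HasNonsingularReduction (Affine.Point.congrEquiv hX (.some _ _ hL)) :=
      (hred_some _ _ a.2 b.2 hL hnsb).2
    have hE0nb : W₀.HasNonsingularReduction (-Affine.Point.congrEquiv hX (.some _ _ hL)) := hE0b.neg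
    have hE0in := (hE0φb.add hvw hE0nb).neg
    have hE0all := hE0m.add hvw hE0in
    rw [← hker, sub_eq_add_neg, sub_eq_add_neg, map_add, map_neg, map_add, map_neg,
      ← reducePoint_eq_zero_iff hvw hE0all, reducePoint_add hvw hE0m hE0in,
      reducePoint_neg hvw.hom_inj, reducePoint_add hvw hE0φb hE0nb, reducePoint_neg hvw.hom_inj]
    change red (.some _ _ hm) + -(red _ + -red (.some _ _ hL)) = 0
    apply (Affine.Point.congrEquiv hWt').injective
    rw [map_zero, map_add, map_neg, map_add, map_neg, ← hQ₁, hredφb, hredb,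
      congrEquiv_apply_congrEquiv_symm, ← hQ₁']
    abel

end Summit.BirchSwinnertonDyer.Rank1Residual.GaloisImage.TwistedWitness

end
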